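import Summits.QuantumFields.BalabanUV.Beta.GAN24.FineReadoutCauchyDecThree
import Summits.QuantumFields.BalabanUV.Beta.GAN24.RespStepDecay

/-!
# `BalabanUV.Beta.GAN24.RespStepCauchy` — binder row G-an2-4 / (CONV-C), CT-ROUTE step CT-4 (owner's design `gen17/CT-ROUTE-v1.md` §3 CT-4,
# `gen19/CT4-DESIGN-v0.md`, journal [GAN24P1-G19-A1] «CT-4-LEGS»): THE TOP-ALIGNED CAUCHY LETTER «(C-N1_m)» OF THE DECIMATED COMPOSITE MINIMISER
# COLUMNS `respStep (Lc^s) (Lc^(s+k+1))` AT EVERY BASE LEVEL `s`, UNCONDITIONALLY AT `d = 3` — by counting from «(N1-Cauchy)»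

NOT IN PRINT; OUR PROOF ATTEMPT (of the route; THIS file is [folklore] packaging: the analytic CONTENT is the T-N1C team's TREE theorem
«(N1-Cauchy)» `FineReadoutCauchyHolds.exists_wH_cellMean_cauchy` in leaf-19's `dec Lc` currency `FineReadoutCauchyDecThree.dec_cauchy_three`
— the `Lc`-block-contour mean of the next level's normalised column against this level's column is `n`-geometric — consumed BY NAME; the rest is
an5's semigroup law of block-contour sums `ResolventComposition.contourSum_mul` (`𝒬_{ML} = 𝒬_L ∘ 𝒬_M`) and leaf-12's `RespStepDecay` smearing
pattern: the `Lc^s`-block contour of an ℓ∞-block envelope costs `M^{d+2}` points and one label step).  HONEST FRAMING (cell contract, verbatim):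
«discharging `BetaPertH` makes Bałaban's UV stability UNCONDITIONAL — a real constructive-QFT result; it is NOT the continuum limit and NOT the
Clay problem.»  HONEST DEPENDENCY (verbatim): «continuum YM on T⁴ ⇐ BetaPertH ∧ nine spine estimates (0/9 proved); BetaPertH ⇐ (D1) ∧ (D4) ∧
CAP+tail; G-an2-4 gates asym, D1 and NE2/3/4.»  No cited fact, no wall binder, no `def`, no `def … : Prop`; discharges NOTHING of (hS, hSall) on
(E) — it is the leg-DIFFERENCE input (α) of CT-4 (the same-depth gauge-piece differences of two consecutive towers, top-aligned); NEVER «G-an2-4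
closed»; NOT `BetaPertH`, NOT continuum, NOT Clay.

## The statement in words
Tower `n+1` (fine blocking `Lc^(s+k+2)`) read on ITS level `s+1` and tower `n` (fine blocking `Lc^(s+k+1)`) read on its level `s` are 1-forms on the
SAME lattice (top-aligned: relative blocking `L = Lc^(k+1)` in both); their difference is `c·θ^(s+k)·(L^5)⁻¹·e^{−κ₁‖quo L w − z‖∞}` — the rate is
geometric in the FINE level `n = s + k`, uniformly in the base `s`, two facts deep: `respStep (Lc^(s+1)) N″ = contourSum (Lc^s) (respStep Lc N″)`
and `respStep Lc N″ − respStep 1 N′ = (N′^5)⁻¹·[dec-mean of H̃_{N″} − H̃_{N′}]` with `H̃_N = N^5·wH_N`.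

## What is proved
* §1 (generic `d`) `supNorm_le_l1`, `contourSum_sub`, `respStep_pow_succ_eq_contourSum` (`respStep (Lc^(s+1)) N″ μ z = contourSum (Lc^s) (respStep Lc N″ μ z)`),
  `respStep_pow_eq_contourSum_one` (`respStep (Lc^s) N′ μ z = contourSum (Lc^s) (respStep 1 N′ μ z)`), `respStep_eq_translate_zero`
  (`respStep M N′ μ z l w = respStep M N′ μ 0 l (w − L•z)`, `N′ = M·L`), **`abs_contourSum_le_of_env`** (the `M^{d+2}`-point smearing of an
  ℓ∞-block envelope at blocking `M·L` into one at blocking `L`, leaf-12's pattern for a general 1-form).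
* §2 (generic `d`) `sum_legSet_inl_eq` (leaf-04∕leaf-19's `dec`-leg sum over `legSet d Lc (inl κ)` IS the `Lc`-block contour sum: `legPt` = contour point,
  `legW = (Lc^{d+2})⁻¹`), hence `respStep_Lc_sub_respStep_one_eq` (the displayed identity above, any `d`).
* §3 (`d = 3`, every `Lc ≥ 2`, NO hypothesis) **`exists_respStep_cauchy`**:
  `∃ c θ κ₁, 0 ≤ c ∧ 0 ≤ θ ∧ θ < 1 ∧ 0 < κ₁ ∧ ∀ s k μ z l w,
   |respStep (Lc^(s+1)) (Lc^(s+k+2)) μ z l w − respStep (Lc^s) (Lc^(s+k+1)) μ z l w| ≤ c·θ^(s+k)·((Lc^(k+1))^5)⁻¹·e^{−κ₁‖quo (Lc^(k+1)) w − z‖∞}`.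
Unit `b2b-balaban-gan24-p1` (row owner G-an2-4, gen 19), 2026-08-21.
-/

noncomputable section

open Finset
open scoped BigOperators
open Literature.MathematicalPhysics.QuantumFieldTheory
open Literature.MathematicalPhysics.QuantumFieldTheory.LatticeForm (quo)
open Literature.MathematicalPhysics.QuantumFieldTheory.Balaban1983to89
open Literature.MathematicalPhysics.QuantumFieldTheory.Balaban1983to89.Beta
open B12Sec2to5 (l1 l1_nonneg)
open B4ContourShift (supNorm supNorm_nonneg exists_supNorm_eq)
open KernelSpecInstance (wH)
open AffineAveraging (Form1 Site box toSite unitVec contourSum)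
open OneStepResolventKernel (Fib)
open OneStepKernelFamily (legSet legPt legW LegIdx)
open BlochFibreUniqueness (quo_add_zsmul)
open ResolventComposition (Hcol Hcol_apply contourSum_mul)
open BalabanCompositeJets (respStep)
open Summit.QuantumFields.BalabanUV.Beta.GAN24.RespStepDecay (respStep_eq_sum respStep_one respStep_translate supNorm_quo_sub_le_add exp_wobble
  contour_offset_lt card_box_mul_card_range)
open Summit.QuantumFields.BalabanUV.Beta.GAN24.FineReadoutCauchyDecThree (dec_cauchy_three)

namespace Summit.QuantumFields.BalabanUV.Beta.GAN24.RespStepCauchy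

variable {d : ℕ}

/-! ## §1 Bookkeeping: norms, linearity, the semigroup of contour sums, translation, smearing -/

/-- [folklore] `‖x‖∞ ≤ |x|₁`. -/
theorem supNorm_le_l1 (x : Fin (d + 1) → ℤ) : supNorm x ≤ l1 x := by
  obtain ⟨i, hi⟩ := exists_supNorm_eq x
  rw [hi, Int.cast_abs]
  unfold l1
  exact Finset.single_le_sum (f := fun j => |((x j : ℤ) : ℝ)|) (fun j _ => abs_nonneg _) (Finset.mem_univ i)

/-- [folklore] The block-contour sum is linear: `contourSum M (A − B) = contourSum M A − contourSum M B`. -/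
theorem contourSum_sub (M : ℕ) (A B : Form1 (d + 1) ℝ) : contourSum M (A - B) = contourSum M A - contourSum M B := by
  funext κ y
  simp only [contourSum, Pi.sub_apply, Finset.sum_sub_distrib]

/-- [folklore] **ONE MORE READ-OUT LEVEL IS ONE MORE CONTOUR SUM**: `respStep (Lc^(s+1)) N″ μ z = contourSum (Lc^s) (respStep Lc N″ μ z)`
(an5's `contourSum_mul`: `𝒬_{Lc·Lc^s} = 𝒬_{Lc^s} ∘ 𝒬_{Lc}`). -/
theorem respStep_pow_succ_eq_contourSum {Lc : ℕ} [NeZero Lc] (N'' : ℕ) [NeZero N''] (s : ℕ) (μ : Fin (d + 1)) (z : Site (d + 1)) :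
    respStep (d := d) (Lc ^ (s + 1)) N'' μ z = contourSum (Lc ^ s) (respStep (d := d) Lc N'' μ z) := by
  funext l w
  have hLc : 0 < Lc := Nat.pos_of_ne_zero (NeZero.ne Lc)
  show contourSum (Lc ^ (s + 1)) (Hcol (N := N'') (d := d) μ z) l w = contourSum (Lc ^ s) (fun l v => contourSum Lc (Hcol (N := N'') μ z) l v) l w
  rw [pow_succ', contourSum_mul Lc (Lc ^ s) hLc]

/-- [folklore] … and the base tower's column read on its level `s` is the `Lc^s`-contour sum of the fine column itself:
`respStep (Lc^s) N′ μ z = contourSum (Lc^s) (respStep 1 N′ μ z)`. -/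
theorem respStep_pow_eq_contourSum_one {Lc : ℕ} [NeZero Lc] (N' : ℕ) [NeZero N'] (s : ℕ) (μ : Fin (d + 1)) (z : Site (d + 1)) :
    respStep (d := d) (Lc ^ s) N' μ z = contourSum (Lc ^ s) (respStep (d := d) 1 N' μ z) := by
  have h1 : respStep (d := d) 1 N' μ z = Hcol (N := N') (d := d) μ z := by
    funext l w
    rw [respStep_one, Hcol_apply]
  rw [h1]
  rfl

/-- [folklore] Joint block covariance read backwards: `respStep M N′ μ z l w = respStep M N′ μ 0 l (w − L•z)` (`N′ = M·L`). -/
theorem respStep_eq_translate_zero {M L N' : ℕ} [NeZero N'] (hN : N' = M * L) (μ : Fin (d + 1)) (z : Site (d + 1)) (l : Fin (d + 1))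
    (w : Site (d + 1)) : respStep (d := d) M N' μ z l w = respStep (d := d) M N' μ 0 l (w - (L : ℤ) • z) := by
  have h := respStep_translate (d := d) (M := M) (L := L) hN μ (0 : Fin (d + 1) → ℤ) l (w - (L : ℤ) • z) z
  have e1 : (0 : Fin (d + 1) → ℤ) + z = z := zero_add z
  have e2 : w - (L : ℤ) • z + (L : ℤ) • z = w := sub_add_cancel w _
  simp only [e1, e2] at h
  exact h

/-- [folklore] **SMEARING AN ℓ∞-BLOCK ENVELOPE THROUGH THE `M`-BLOCK CONTOUR** (leaf-12's `abs_respStep_le` for a general 1-form): if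
`|A κ v| ≤ a·e^{−κ₀‖quo (M·L) v‖∞}` then `|contourSum M A l w| ≤ (M^{d+2}·a·e^{κ₀})·e^{−κ₀‖quo L w‖∞}` — `M^{d+1}·M` contour points, each one label
step from `quo L w`. -/
theorem abs_contourSum_le_of_env {M L : ℕ} [NeZero M] [NeZero L] {a κ₀ : ℝ} (ha : 0 ≤ a) (hκ : 0 ≤ κ₀) {A : Form1 (d + 1) ℝ}
    (hA : ∀ (κ : Fin (d + 1)) (v : Site (d + 1)), |A κ v| ≤ a * Real.exp (-(κ₀ * supNorm (quo (M * L) v))))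
    (l : Fin (d + 1)) (w : Site (d + 1)) :
    |contourSum M A l w| ≤ ((M : ℝ) ^ (d + 2) * a * Real.exp κ₀) * Real.exp (-(κ₀ * supNorm (quo L w))) := by
  haveI : NeZero (M * L) := ⟨mul_ne_zero (NeZero.ne M) (NeZero.ne L)⟩
  unfold contourSum
  have hterm : ∀ b ∈ box (d + 1) M, ∀ s ∈ Finset.range M,
      |A l ((M : ℤ) • w + toSite b + (s : ℤ) • unitVec l)| ≤ a * Real.exp κ₀ * Real.exp (-(κ₀ * supNorm (quo L w))) := by
    intro b hb s hs
    have hs' : s < M := Finset.mem_range.1 hs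
    have hr := fun i => contour_offset_lt (d := d) hb hs' l i
    have hlab := supNorm_quo_sub_le_add M L w 0 hr (n := 1)
    rw [sub_zero, smul_zero, sub_zero] at hlab
    refine (hA l _).trans ?_
    rw [add_assoc]
    have hw := exp_wobble hκ hlab
    rw [Nat.cast_one, one_mul] at hw
    calc a * Real.exp (-(κ₀ * supNorm (quo (M * L) ((M : ℤ) • w + (toSite b + (s : ℤ) • unitVec l)))))
        ≤ a * (Real.exp κ₀ * Real.exp (-(κ₀ * supNorm (quo L w)))) := mul_le_mul_of_nonneg_left hw ha
      _ = a * Real.exp κ₀ * Real.exp (-(κ₀ * supNorm (quo L w))) := by ring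
  calc |∑ b ∈ box (d + 1) M, ∑ s ∈ Finset.range M, A l ((M : ℤ) • w + toSite b + (s : ℤ) • unitVec l)|
      ≤ ∑ b ∈ box (d + 1) M, ∑ s ∈ Finset.range M, |A l ((M : ℤ) • w + toSite b + (s : ℤ) • unitVec l)| :=
        (abs_sum_le_sum_abs _ _).trans (sum_le_sum fun b _ => abs_sum_le_sum_abs _ _)
    _ ≤ ∑ b ∈ box (d + 1) M, ∑ _s ∈ Finset.range M, a * Real.exp κ₀ * Real.exp (-(κ₀ * supNorm (quo L w))) :=
        sum_le_sum fun b hb => sum_le_sum fun s hs => hterm b hb s hs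
    _ = ((M : ℝ) ^ (d + 2) * a * Real.exp κ₀) * Real.exp (-(κ₀ * supNorm (quo L w))) := by
        rw [sum_const, sum_const, smul_smul, nsmul_eq_mul, Nat.cast_mul, card_box_mul_card_range]
        ring

/-! ## §2 The `dec`-leg sum of leaf-04∕leaf-19 IS the `Lc`-block contour sum -/

/-- [folklore] The fine point of a field-leg index is the contour point: `legPt M (inl κ) x′ (b, s) = M•x′ + b + s•e_κ`. -/
theorem legPt_inl_eq (M : ℕ) (κ : Fin (d + 1)) (x' : Site (d + 1)) (b : Fin (d + 1) → ℕ) (s : ℕ) :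
    legPt (d := d) M (Sum.inl κ) x' (b, s) = (M : ℤ) • x' + toSite b + (s : ℤ) • unitVec κ := by
  funext j
  simp only [legPt, toSite, unitVec, Pi.add_apply, Pi.smul_apply, Pi.single_apply, smul_eq_mul]
  split_ifs <;> ring

/-- [folklore] **THE `dec` FIELD-LEG SUM IS THE NORMALISED `Lc`-BLOCK CONTOUR SUM**: for any function `F` of the fine point,
`Σ_{i ∈ legSet d M (inl κ)} legW d M (inl κ)·F (legPt M (inl κ) x′ i) = (M^{d+2})⁻¹·Σ_{b ∈ box M} Σ_{s < M} F (M•x′ + b + s•e_κ)`. -/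
theorem sum_legSet_inl_eq (M : ℕ) (κ : Fin (d + 1)) (x' : Site (d + 1)) (F : Site (d + 1) → ℝ) :
    ∑ i ∈ legSet d M (Sum.inl κ), legW d M (Sum.inl κ) * F (legPt (d := d) M (Sum.inl κ) x' i)
      = (((M : ℝ) ^ (d + 2)))⁻¹ * ∑ b ∈ box (d + 1) M, ∑ s ∈ Finset.range M, F ((M : ℤ) • x' + toSite b + (s : ℤ) • unitVec κ) := by
  simp only [legSet, legW, LegIdx]
  rw [← Finset.mul_sum, Finset.sum_product]
  refine congrArg _ (Finset.sum_congr rfl fun b _ => Finset.sum_congr rfl fun s _ => ?_)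
  rw [legPt_inl_eq]

/-- [folklore] **THE ONE-STEP DIFFERENCE IN «(N1-Cauchy)»'s CURRENCY** (any `d`, `N″ = Lc·N′`): at source block `0`,
`respStep Lc N″ μ 0 l v − respStep 1 N′ μ 0 l v = ((N′^{d+2})⁻¹)·[Σ_{i ∈ legSet d Lc (inl l)} legW·(N″^{d+2}·wH_{N″} l μ (legPt Lc (inl l) v i)) − N′^{d+2}·wH_{N′} l μ v]`
— the bracket is EXACTLY the quantity `dec_cauchy_three` bounds (with its `(κ, l, z, a) := (l, μ, v, inl l)`). -/
theorem respStep_Lc_sub_respStep_one_eq {Lc N' N'' : ℕ} [NeZero Lc] [NeZero N'] [NeZero N''] (hN : N'' = Lc * N') (μ : Fin (d + 1))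
    (l : Fin (d + 1)) (v : Site (d + 1)) :
    respStep (d := d) Lc N'' μ 0 l v - respStep (d := d) 1 N' μ 0 l v
      = (((N' : ℝ) ^ (d + 2)))⁻¹ *
        (∑ i ∈ legSet d Lc (Sum.inl l), legW d Lc (Sum.inl l) * (((N'' : ℝ)) ^ (d + 2) * wH (N := N'') l μ (legPt (d := d) Lc (Sum.inl l) v i))
          - ((N' : ℝ)) ^ (d + 2) * wH (N := N') l μ v) := by
  have hN' : (0 : ℝ) < (N' : ℝ) := by exact_mod_cast Nat.pos_of_ne_zero (NeZero.ne N')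
  have hLc : (0 : ℝ) < (Lc : ℝ) := by exact_mod_cast Nat.pos_of_ne_zero (NeZero.ne Lc)
  have hs := sum_legSet_inl_eq (d := d) Lc l v (fun p => ((N'' : ℝ)) ^ (d + 2) * wH (N := N'') l μ p)
  rw [hs, respStep_eq_sum, respStep_one]
  simp only [smul_zero, sub_zero, ← Finset.mul_sum]
  have e : (((Lc : ℝ) ^ (d + 2)))⁻¹ * ((N'' : ℝ)) ^ (d + 2) = ((N' : ℝ)) ^ (d + 2) := by
    rw [hN, Nat.cast_mul, mul_pow, ← mul_assoc, inv_mul_cancel₀ (by positivity), one_mul]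
  have e2 : (((N' : ℝ) ^ (d + 2)))⁻¹ * ((((Lc : ℝ) ^ (d + 2)))⁻¹ * (((N'' : ℝ)) ^ (d + 2) *
      ∑ b ∈ box (d + 1) Lc, ∑ s ∈ Finset.range Lc, wH (N := N'') l μ ((Lc : ℤ) • v + toSite b + (s : ℤ) • unitVec l)))
      = ∑ b ∈ box (d + 1) Lc, ∑ s ∈ Finset.range Lc, wH (N := N'') l μ ((Lc : ℤ) • v + toSite b + (s : ℤ) • unitVec l) := by
    rw [← mul_assoc, ← mul_assoc, mul_assoc ((((N' : ℝ) ^ (d + 2)))⁻¹), e, inv_mul_cancel₀ (by positivity), one_mul]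
  rw [mul_sub, e2, inv_mul_cancel_left₀ (by positivity)]
  simp only [add_assoc]

/-! ## §3 `d = 3`: «(C-N1_m)» — the top-aligned Cauchy letter of the decimated composite columns at every base, unconditionally -/

section Four

variable {Lc : ℕ} [NeZero Lc]

/-- NOT IN PRINT; OUR PROOF ([folklore] packaging of «(N1-Cauchy)», `FineReadoutCauchyDecThree.dec_cauchy_three` BY NAME).
**«(C-N1_m)» — THE DECIMATED COMPOSITE MINIMISER COLUMNS OF TWO CONSECUTIVE TOWERS, TOP-ALIGNED, AT EVERY BASE LEVEL** (`d = 3`, every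
`Lc ≥ 2`): ONE rate `θ < 1`, ONE decay rate `κ₁ > 0` and ONE constant `c ≥ 0` such that for ALL base levels `s`, relative depths `k`, bonds
`(μ, z)`, `(l, w)`:
`|respStep (Lc^(s+1)) (Lc^(s+k+2)) μ z l w − respStep (Lc^s) (Lc^(s+k+1)) μ z l w| ≤ c·θ^(s+k)·((Lc^(k+1))^5)⁻¹·e^{−κ₁‖quo (Lc^(k+1)) w − z‖∞}`
— geometric in the FINE level `n = s + k`, uniform in the base; at `s = 0` the `dec Lc` form of «(N1-Cauchy)» itself (translated to the source
block `z`, ℓ¹ label envelope weakened to ℓ∞).  The leg-difference input (α) of CT-4 (`gen19/CT4-DESIGN-v0.md`). -/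
theorem exists_respStep_cauchy (hLc : 2 ≤ Lc) :
    ∃ c θ κ₁ : ℝ, 0 ≤ c ∧ 0 ≤ θ ∧ θ < 1 ∧ 0 < κ₁ ∧
      ∀ (s k : ℕ) (μ : Fin (3 + 1)) (z : Site (3 + 1)) (l : Fin (3 + 1)) (w : Site (3 + 1)),
        |respStep (d := 3) (Lc ^ (s + 1)) (Lc ^ (s + k + 2)) μ z l w - respStep (d := 3) (Lc ^ s) (Lc ^ (s + k + 1)) μ z l w|
          ≤ c * θ ^ (s + k) * ((((Lc ^ (k + 1) : ℕ) : ℝ)) ^ (3 + 2))⁻¹ * Real.exp (-(κ₁ * supNorm (quo (Lc ^ (k + 1)) w - z))) := by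
  obtain ⟨c', θ', κ', hc', hθ0, hθ1, hκ', hD⟩ := dec_cauchy_three (Lc := Lc) hLc
  have hL : (0 : ℝ) < (Lc : ℝ) := by exact_mod_cast Nat.pos_of_ne_zero (NeZero.ne Lc)
  refine ⟨c' * Real.exp κ', θ', κ', by positivity, hθ0, hθ1, hκ', fun s k μ z l w => ?_⟩
  -- names: base read-out `M = Lc^s`, relative blocking `L = Lc^(k+1)`, the two fine levels `N′ = M·L`, `N″ = Lc·N′`
  have hN' : Lc ^ (s + k + 1) = Lc ^ s * Lc ^ (k + 1) := by rw [← pow_add, add_assoc]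
  have hN'' : Lc ^ (s + k + 2) = Lc ^ (s + 1) * Lc ^ (k + 1) := by rw [← pow_add]; ring_nf
  have hN3 : Lc ^ (s + k + 2) = Lc * Lc ^ (s + k + 1) := by rw [← pow_succ']
  -- translate the source block to `0`
  rw [respStep_eq_translate_zero (d := 3) hN'' μ z l w, respStep_eq_translate_zero (d := 3) hN' μ z l w]
  set w₀ := w - ((Lc ^ (k + 1) : ℕ) : ℤ) • z with hw₀
  -- one more read-out level = one more contour sum; the difference is the `Lc^s`-contour of the one-step difference
  rw [respStep_pow_succ_eq_contourSum, respStep_pow_eq_contourSum_one]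
  have hcs : contourSum (Lc ^ s) (respStep (d := 3) Lc (Lc ^ (s + k + 2)) μ 0) l w₀
        - contourSum (Lc ^ s) (respStep (d := 3) 1 (Lc ^ (s + k + 1)) μ 0) l w₀
      = contourSum (Lc ^ s) (respStep (d := 3) Lc (Lc ^ (s + k + 2)) μ 0 - respStep (d := 3) 1 (Lc ^ (s + k + 1)) μ 0) l w₀ := by
    rw [contourSum_sub]; rfl
  rw [hcs]
  -- the one-step difference has the «(N1-Cauchy)» envelope at blocking `N′ = M·L`
  have hδ : ∀ (κ : Fin (3 + 1)) (v : Site (3 + 1)),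
      |(respStep (d := 3) Lc (Lc ^ (s + k + 2)) μ 0 - respStep (d := 3) 1 (Lc ^ (s + k + 1)) μ 0) κ v|
        ≤ c' * θ' ^ (s + k) * ((((Lc ^ (s + k + 1) : ℕ) : ℝ)) ^ (3 + 2))⁻¹ *
            Real.exp (-(κ' * supNorm (quo (Lc ^ s * Lc ^ (k + 1)) v))) := by
    intro κ v
    have h := hD (s + k) κ μ v (Sum.inl κ)
    have hid := respStep_Lc_sub_respStep_one_eq (d := 3) hN3 μ κ v
    rw [Pi.sub_apply, Pi.sub_apply, hid, abs_mul, abs_inv]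
    push_cast at h ⊢
    rw [abs_of_nonneg (by positivity : (0 : ℝ) ≤ ((Lc : ℝ) ^ (s + k + 1)) ^ (3 + 2))]
    have henv : Real.exp (-κ' * l1 (quo (Lc ^ (s + k + 1)) v)) ≤ Real.exp (-(κ' * supNorm (quo (Lc ^ s * Lc ^ (k + 1)) v))) := by
      rw [← hN', Real.exp_le_exp, neg_mul, neg_le_neg_iff]
      exact mul_le_mul_of_nonneg_left (supNorm_le_l1 _) hκ'.le
    refine (mul_le_mul_of_nonneg_left h (by positivity)).trans ?_
    calc (((Lc : ℝ) ^ (s + k + 1)) ^ (3 + 2))⁻¹ * (c' * θ' ^ (s + k) * Real.exp (-κ' * l1 (quo (Lc ^ (s + k + 1)) v)))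
        ≤ (((Lc : ℝ) ^ (s + k + 1)) ^ (3 + 2))⁻¹ * (c' * θ' ^ (s + k) * Real.exp (-(κ' * supNorm (quo (Lc ^ s * Lc ^ (k + 1)) v)))) :=
          mul_le_mul_of_nonneg_left (mul_le_mul_of_nonneg_left henv (by positivity)) (by positivity)
      _ = c' * θ' ^ (s + k) * (((Lc : ℝ) ^ (s + k + 1)) ^ (3 + 2))⁻¹ * Real.exp (-(κ' * supNorm (quo (Lc ^ s * Lc ^ (k + 1)) v))) := by ring
  -- smear through the `Lc^s`-contour: `M^5` points, one label step
  have hA : 0 ≤ c' * θ' ^ (s + k) * ((((Lc ^ (s + k + 1) : ℕ) : ℝ)) ^ (3 + 2))⁻¹ := by positivity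
  have hsm := abs_contourSum_le_of_env (d := 3) (M := Lc ^ s) (L := Lc ^ (k + 1)) hA hκ'.le hδ l w₀
  refine hsm.trans (le_of_eq ?_)
  -- the envelope: `quo L (w − L•z) = quo L w − z`; the power count `M^5·(N′^5)⁻¹ = (L^5)⁻¹`
  have hlab : quo (Lc ^ (k + 1)) w₀ = quo (Lc ^ (k + 1)) w - z := by
    rw [hw₀, sub_eq_add_neg, ← smul_neg, quo_add_zsmul, ← sub_eq_add_neg]
  have e : (((Lc ^ s : ℕ) : ℝ)) ^ (3 + 2) * ((((Lc ^ (s + k + 1) : ℕ) : ℝ)) ^ (3 + 2))⁻¹ = ((((Lc ^ (k + 1) : ℕ) : ℝ)) ^ (3 + 2))⁻¹ := by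
    push_cast
    rw [show (Lc : ℝ) ^ (s + k + 1) = (Lc : ℝ) ^ s * (Lc : ℝ) ^ (k + 1) by rw [← pow_add, add_assoc], mul_pow, mul_inv, ← mul_assoc,
      mul_inv_cancel₀ (by positivity), one_mul]
  rw [hlab]
  calc (((Lc ^ s : ℕ) : ℝ)) ^ (3 + 2) * (c' * θ' ^ (s + k) * ((((Lc ^ (s + k + 1) : ℕ) : ℝ)) ^ (3 + 2))⁻¹) * Real.exp κ' *
        Real.exp (-(κ' * supNorm (quo (Lc ^ (k + 1)) w - z)))
      = c' * Real.exp κ' * θ' ^ (s + k) * ((((Lc ^ s : ℕ) : ℝ)) ^ (3 + 2) * ((((Lc ^ (s + k + 1) : ℕ) : ℝ)) ^ (3 + 2))⁻¹) *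
        Real.exp (-(κ' * supNorm (quo (Lc ^ (k + 1)) w - z))) := by ring
    _ = _ := by rw [e]

end Four

end Summit.QuantumFields.BalabanUV.Beta.GAN24.RespStepCauchy

end
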